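import Mathlib
import Summits.MatrixMultiplication.MatrixMultiplication.Theorems.NilpotentLieHostsHostingBound
import Summits.MatrixMultiplication.MatrixMultiplication.Theorems.OrbitHarmonicsHostsTruncatedPolynomialVacuityBorderRank
import Literature.Computability.AlgebraicComplexity.LaserSymmetrization
import Literature.Computability.AlgebraicComplexity.AsymptoticRankMatMul
import Literature.Computability.AlgebraicComplexity.AsymptoticRankBorderRank
import Literature.Barriers.MatrixMultiplication.UniversalMethodBarrierAsymptoticRank
import Literature.RingTheory.MvPolynomial.MonomialCompleteIntersection

/-!
# `UnitriangularCostShape` — stub `stub_truncatedMatrixCost` (line `registered`, crux stmt-MatrixMultiplication-7724)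

Route `MatrixMultiplication/NilpotentLieHosts`, crux `UnitriangularCostShape`, BC3 birth skeleton
(`Cruxes/UnitriangularCostShape/Lines/birth.lean`), stub 3: **the cost of the truncated matrix
host**.  Write `R_{k,t} := ℂ[z₁,…,z_k]/(z₁^t,…,z_k^t)`
(`MvPolynomial (Fin k) ℂ ⧸ Ideal.span (Set.range fun i => X i ^ t)`) and `A := M_N(R_{k,t})`.
If `ℂ`-linear maps `α, β, γ` host `⟨n, l, p⟩` in `A` (`γ (α M · β M') = M M'`), then
`(n l p)^{ω/3} ≤ κ_k · N^ω · t^k`; in fact `κ_k = 1`.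

Proof.
* `R_{k,t}` has the monomial basis `z^e`, `e ∈ [t]^k` (standard monomials of the monomial ideal
  `(z_i^t)`, via the tree's membership criterion `Literature.RingTheory.MvPolynomial.mem_span_X_pow_iff`
  for `(x_i^e)`: `linearIndependent_mono`, `span_mono`), with multiplication table `z^x z^y = z^{x+y}` if all `x_i + y_i < t`, else `0`
  (`mono_mul_mono`); hence its structure tensor is the `k`-th Kronecker power of the truncated
  polynomial multiplication tensor `T_t(c, a, b) = [a + b = c]`
  (`structureTensor_basisMk_eq_kroneckerPow`).
* `A = M_N(R_{k,t})` has the basis `E_{ij} ⊗ z^e` (`Module.Basis.matrix`), whose structure tensor is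
  a relabelling of `⟨N,N,N⟩ ⊗ T_{R_{k,t}}` (`structureTensor_basisMatrix_apply`), hence
  `R̃(T_A) ≤ R̃(⟨N,N,N⟩) · R̃(T_t^{⊗k}) ≤ N^ω · t^k` by `asymptoticRank_kronecker_le`,
  `asymptoticRank_matMulTensor_le_rpow_omega`, `asymptoticRank_kroneckerPow_le`,
  `asymptoticRank_le_of_algBorderRank_le` and Bini's bound `bR(T_t) ≤ t`
  (`algBorderRank_truncPoly_le`, file `OrbitHarmonicsHostsTruncatedPolynomialVacuityBorderRank`).
* The route's proved support item `HostingBound` (`hostingBound_proof`) gives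
  `(n l p)^{ω/3} ≤ R̃(T_A)`.

The file introduces no definitions: the ideal `(z_i^t)`, the quotient ring, the exponent vector
`Finsupp.equivFunOnFinite.symm (fun i => (e i : ℕ))` of a grid point `e : Fin k → Fin t` and the
standard monomials are written inline, and the basis is `Module.Basis.mk` of the monomial family.

References: [BlasiakCohnGrochowPrattUmans2024, Thm. 2.2, Rem. 2.4], [CohnUmans2003, Thm. 4.1],
[BurgisserClausenShokrollahi1997, §14.2, (15.11)], [Blaser2013, Def. 6.1, §9.2].
-/

-- `Summit.MatrixMultiplication.MatrixMultiplication.…` is the tree's mandated summit-side namespace.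
set_option linter.dupNamespace false

noncomputable section

open scoped BigOperators

namespace Summit.MatrixMultiplication.MatrixMultiplication.Theorems.UnitriangularCostShape

open Literature.Computability.AlgebraicComplexity
open Literature.Barriers.MatrixMultiplication (asymptoticRank_le_of_polyDegeneratesTo
  asymptoticRank_kroneckerPow_le)

/-! ## The truncated polynomial ring `R_{k,t} = ℂ[z₁,…,z_k]/(z_i^t)` and its standard monomials -/

section TruncRing

variable (k t : ℕ)

/-- A monomial with some exponent `≥ t` vanishes in `R_{k,t}` (the tree's
`monomial_mem_span_X_pow_iff`). -/
theorem mk_monomial_eq_zero {m : Fin k →₀ ℕ} {i : Fin k} (hi : t ≤ m i) :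
    Ideal.Quotient.mk (Ideal.span (Set.range fun i : Fin k =>
        (MvPolynomial.X i : MvPolynomial (Fin k) ℂ) ^ t)) (MvPolynomial.monomial m (1 : ℂ)) = 0 := by
  rw [Ideal.Quotient.eq_zero_iff_mem,
    Literature.RingTheory.MvPolynomial.monomial_mem_span_X_pow_iff one_ne_zero]
  exact ⟨i, hi⟩

/-- Scalar multiples of monomials in the quotient `R_{k,t}`. -/
theorem smul_mk_monomial_one (c : ℂ) (m : Fin k →₀ ℕ) :
    c • Ideal.Quotient.mk (Ideal.span (Set.range fun i : Fin k =>
        (MvPolynomial.X i : MvPolynomial (Fin k) ℂ) ^ t)) (MvPolynomial.monomial m 1) =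
      Ideal.Quotient.mk (Ideal.span (Set.range fun i : Fin k =>
        (MvPolynomial.X i : MvPolynomial (Fin k) ℂ) ^ t)) (MvPolynomial.monomial m c) := by
  rw [← Ideal.Quotient.mkₐ_eq_mk ℂ, ← map_smul, MvPolynomial.smul_monomial, smul_eq_mul, mul_one]

/-- Distinct grid points `e ∈ [t]^k` have distinct exponent vectors. -/
theorem expOf_injective :
    Function.Injective fun e : Fin k → Fin t =>
      (Finsupp.equivFunOnFinite.symm fun i => (e i : ℕ) : Fin k →₀ ℕ) := by
  intro e e' h
  funext i
  exact Fin.ext (by simpa using congrArg (fun m : Fin k →₀ ℕ => m i) h)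

/-- Multiplication table of the standard monomials `z^e`, `e ∈ [t]^k`, of `R_{k,t}`:
`z^x · z^y = z^{x+y}` if all `x_i + y_i < t`, and `0` otherwise. -/
theorem mono_mul_mono (x y : Fin k → Fin t) :
    Ideal.Quotient.mk (Ideal.span (Set.range fun i : Fin k =>
        (MvPolynomial.X i : MvPolynomial (Fin k) ℂ) ^ t))
        (MvPolynomial.monomial (Finsupp.equivFunOnFinite.symm fun i => (x i : ℕ)) (1 : ℂ)) *
      Ideal.Quotient.mk (Ideal.span (Set.range fun i : Fin k =>
        (MvPolynomial.X i : MvPolynomial (Fin k) ℂ) ^ t))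
        (MvPolynomial.monomial (Finsupp.equivFunOnFinite.symm fun i => (y i : ℕ)) (1 : ℂ)) =
      if h : ∀ i, (x i : ℕ) + y i < t then
        Ideal.Quotient.mk (Ideal.span (Set.range fun i : Fin k =>
          (MvPolynomial.X i : MvPolynomial (Fin k) ℂ) ^ t))
          (MvPolynomial.monomial
            (Finsupp.equivFunOnFinite.symm fun i => ((⟨x i + y i, h i⟩ : Fin t) : ℕ)) (1 : ℂ))
      else 0 := by
  rw [← map_mul, MvPolynomial.monomial_mul, one_mul]
  split_ifs with h
  · have he : ((Finsupp.equivFunOnFinite.symm fun i => (x i : ℕ)) +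
        Finsupp.equivFunOnFinite.symm fun i => (y i : ℕ) : Fin k →₀ ℕ) =
        Finsupp.equivFunOnFinite.symm fun i => ((⟨x i + y i, h i⟩ : Fin t) : ℕ) := by
      ext i
      simp
    rw [he]
  · obtain ⟨i, hi⟩ := not_forall.1 h
    exact mk_monomial_eq_zero k t (i := i) (by simpa using not_lt.1 hi)

/-- The standard monomials `z^e`, `e ∈ [t]^k`, of `R_{k,t}` are linearly independent: a linear
combination `∑ g_e z^e` lying in `(z_i^t)` has all its monomials divisible by some `z_i^t`. -/
theorem linearIndependent_mono :
    LinearIndependent ℂ fun e : Fin k → Fin t =>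
      Ideal.Quotient.mk (Ideal.span (Set.range fun i : Fin k =>
        (MvPolynomial.X i : MvPolynomial (Fin k) ℂ) ^ t))
        (MvPolynomial.monomial (Finsupp.equivFunOnFinite.symm fun i => (e i : ℕ)) (1 : ℂ)) := by
  rw [Fintype.linearIndependent_iff]
  intro g hg e₀
  -- the polynomial `P = ∑ g e · z^e` lies in the ideal
  have hP : (∑ e : Fin k → Fin t, MvPolynomial.monomial
      (Finsupp.equivFunOnFinite.symm fun i => (e i : ℕ)) (g e)) ∈
      Ideal.span (Set.range fun i : Fin k => (MvPolynomial.X i : MvPolynomial (Fin k) ℂ) ^ t) := by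
    rw [← Ideal.Quotient.eq_zero_iff_mem, map_sum, ← hg]
    refine Finset.sum_congr rfl fun e _ => ?_
    rw [smul_mk_monomial_one]
  -- its coefficient at `z^{e₀}` is `g e₀`
  have hcoeff : MvPolynomial.coeff (Finsupp.equivFunOnFinite.symm fun i => (e₀ i : ℕ))
      (∑ e : Fin k → Fin t, MvPolynomial.monomial
        (Finsupp.equivFunOnFinite.symm fun i => (e i : ℕ)) (g e)) = g e₀ := by
    rw [MvPolynomial.coeff_sum]
    simp only [MvPolynomial.coeff_monomial]
    rw [Finset.sum_eq_single e₀]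
    · rw [if_pos rfl]
    · intro e _ hne
      rw [if_neg]
      exact fun h => hne (expOf_injective k t h)
    · intro h
      exact absurd (Finset.mem_univ _) h
  by_contra hne
  have hmem : (Finsupp.equivFunOnFinite.symm fun i => (e₀ i : ℕ)) ∈
      (∑ e : Fin k → Fin t, MvPolynomial.monomial
        (Finsupp.equivFunOnFinite.symm fun i => (e i : ℕ)) (g e)).support := by
    rw [MvPolynomial.mem_support_iff, hcoeff]
    exact hne
  obtain ⟨i, hi⟩ := Literature.RingTheory.MvPolynomial.mem_span_X_pow_iff.1 hP _ hmem
  simp only [Finsupp.coe_equivFunOnFinite_symm] at hi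
  exact absurd (e₀ i).2 (not_lt.2 hi)

/-- The standard monomials `z^e`, `e ∈ [t]^k`, span `R_{k,t}`: every other monomial lies in the
ideal `(z_i^t)`. -/
theorem span_mono :
    ⊤ ≤ Submodule.span ℂ (Set.range fun e : Fin k → Fin t =>
      Ideal.Quotient.mk (Ideal.span (Set.range fun i : Fin k =>
        (MvPolynomial.X i : MvPolynomial (Fin k) ℂ) ^ t))
        (MvPolynomial.monomial (Finsupp.equivFunOnFinite.symm fun i => (e i : ℕ)) (1 : ℂ))) := by
  rintro q -
  obtain ⟨p, rfl⟩ := Ideal.Quotient.mk_surjective q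
  rw [MvPolynomial.as_sum p, map_sum]
  refine Submodule.sum_mem _ fun m _ => ?_
  rw [← smul_mk_monomial_one]
  refine Submodule.smul_mem _ _ ?_
  by_cases hm : ∀ i, m i < t
  · -- a standard monomial
    have he : m = Finsupp.equivFunOnFinite.symm fun i => ((⟨m i, hm i⟩ : Fin t) : ℕ) := by
      ext i
      simp
    rw [he]
    exact Submodule.subset_span ⟨fun i => ⟨m i, hm i⟩, rfl⟩
  · -- a monomial of the ideal
    obtain ⟨i, hi⟩ := not_forall.1 hm
    rw [mk_monomial_eq_zero k t (not_lt.1 hi)]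
    exact Submodule.zero_mem _

end TruncRing

/-! ## Structure tensors: truncated multiplication tables and matrix algebras -/

section StructureTensors

/-- **A grid-indexed basis with truncated multiplication table has structure tensor `T_t^{⊗k}`**:
if `v : [t]^k → R` is a basis of the `ℂ`-algebra `R` with `v_x v_y = v_{x+y}` when all
`x_i + y_i < t` and `v_x v_y = 0` otherwise, then the structure tensor of `R` in this basis is the
`k`-th Kronecker power of the truncated polynomial multiplication tensor `T_t(c, a, b) = [a + b = c]`
(the structure tensor of `ℂ[z]/(z^t)`, cf. `algBorderRank_truncPoly_le`). -/
theorem structureTensor_basisMk_eq_kroneckerPow {R : Type*} [Ring R] [Algebra ℂ R] {k t : ℕ}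
    {v : (Fin k → Fin t) → R} (hli : LinearIndependent ℂ v)
    (hsp : ⊤ ≤ Submodule.span ℂ (Set.range v))
    (hmul : ∀ x y, v x * v y =
      if h : ∀ i, (x i : ℕ) + y i < t then v (fun i => ⟨x i + y i, h i⟩) else 0) :
    structureTensor (Module.Basis.mk hli hsp) =
      kroneckerPow (fun c a b : Fin t => if (a : ℕ) + b = c then (1 : ℂ) else 0) k := by
  funext z x y
  rw [structureTensor_apply, Module.Basis.mk_apply, Module.Basis.mk_apply, hmul, kroneckerPow_apply]
  by_cases h : ∀ i, (x i : ℕ) + y i < t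
  · rw [dif_pos h, ← Module.Basis.mk_apply hli hsp, Module.Basis.repr_self, Finsupp.single_apply,
      Fintype.prod_boole]
    by_cases hall : ∀ i, (x i : ℕ) + y i = z i
    · rw [if_pos hall, if_pos]
      funext i
      exact Fin.ext (hall i)
    · rw [if_neg hall, if_neg]
      intro heq
      exact hall fun i => congrArg Fin.val (congrFun heq i)
  · rw [dif_neg h, map_zero, Finsupp.zero_apply]
    obtain ⟨i, hi⟩ := not_forall.1 h
    rw [Finset.prod_eq_zero (Finset.mem_univ i)]
    rw [if_neg]
    intro he
    have hz := (z i).isLt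
    omega

/-- `R̃(T_t^{⊗k}) ≤ t^k` for the truncated polynomial multiplication tensor
`T_t(c, a, b) = [a + b = c]` (Bini: `bR(T_t) ≤ t`, `R̃ ≤ bR`, `R̃(s^{⊗k}) ≤ R̃(s)^k`). -/
theorem asymptoticRank_kroneckerPow_truncPoly_le (k t : ℕ) :
    asymptoticRank (kroneckerPow (fun c a b : Fin t => if (a : ℕ) + b = c then (1 : ℂ) else 0) k) ≤
      (t : ℝ) ^ k := by
  rcases Nat.eq_zero_or_pos k with rfl | hk
  · -- `k = 0`: the empty power is the scalar `1`, of rank `≤ 1`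
    rw [pow_zero]
    refine (asymptoticRank_le_tensorRank_pow_one _).trans ?_
    have h1 : tensorRank (kroneckerPow (kroneckerPow
        (fun c a b : Fin t => if (a : ℕ) + b = c then (1 : ℂ) else 0) 0) 1) ≤ 1 := by
      refine tensorRank_le_of_eq_sum (fun _ _ => 1) (fun _ _ => 1) (fun _ _ => 1) ?_
      funext a b c
      simp [kroneckerPow, triad, Finset.sum_apply]
    exact_mod_cast h1
  · have h1 : asymptoticRank (fun c a b : Fin t => if (a : ℕ) + b = c then (1 : ℂ) else 0) ≤ t :=
      asymptoticRank_le_of_algBorderRank_le (algBorderRank_truncPoly_le t)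
    calc asymptoticRank (kroneckerPow (fun c a b : Fin t => if (a : ℕ) + b = c then (1 : ℂ) else 0) k)
        ≤ asymptoticRank (fun c a b : Fin t => if (a : ℕ) + b = c then (1 : ℂ) else 0) ^ k :=
          asymptoticRank_kroneckerPow_le _ hk
      _ ≤ (t : ℝ) ^ k := pow_le_pow_left₀ (asymptoticRank_nonneg _) h1 k

variable {K : Type*} [Field K] {A : Type*} [Ring A] [Algebra K A] {ι : Type*}
variable (b : Module.Basis ι K A) (N : ℕ)

/-- Coordinates in the basis `E_{ij} ⊗ b_x` of `M_N(A)` (`Module.Basis.matrix`): the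
`(i, j, x)`-coordinate of `M` is the `x`-coordinate of the entry `M i j`. -/
theorem basisMatrix_repr_apply (M : Matrix (Fin N) (Fin N) A) (i j : Fin N) (x : ι) :
    (b.matrix (Fin N) (Fin N)).repr M (i, j, x) = b.repr (M i j) x := by
  simp [Module.Basis.matrix, Module.Basis.repr_reindex_apply, -Module.Basis.repr_reindex]

/-- **The structure tensor of `M_N(A)` in the basis `E_{ij} ⊗ b_x` is `⟨N,N,N⟩ ⊗ T_A` entrywise**:
`(E_{i₁i₂} b_x)(E_{j₁j₂} b_y) = δ_{i₂j₁} E_{i₁j₂} (b_x b_y)`. -/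
theorem structureTensor_basisMatrix_apply (z x y : Fin N × Fin N × ι) :
    structureTensor (b.matrix (Fin N) (Fin N)) z x y =
      matMulTensor K N N N (z.1, z.2.1) (x.1, x.2.1) (y.1, y.2.1) *
        structureTensor b z.2.2 x.2.2 y.2.2 := by
  obtain ⟨k₁, k₂, z⟩ := z
  obtain ⟨i₁, i₂, x⟩ := x
  obtain ⟨j₁, j₂, y⟩ := y
  rw [structureTensor_apply, Module.Basis.matrix_apply, Module.Basis.matrix_apply,
    basisMatrix_repr_apply, structureTensor_apply]
  simp only [matMulTensor]
  by_cases h : i₂ = j₁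
  · subst h
    rw [Matrix.single_mul_single_same, Matrix.single_apply]
    by_cases h' : i₁ = k₁ ∧ j₂ = k₂
    · rw [if_pos h', if_pos ⟨h'.1.symm, rfl, h'.2.symm⟩, one_mul]
    · rw [if_neg h', if_neg (fun hh => h' ⟨hh.1.symm, hh.2.2.symm⟩), zero_mul, map_zero,
        Finsupp.zero_apply]
  · rw [Matrix.single_mul_single_of_ne _ _ _ _ h, Matrix.zero_apply, map_zero, Finsupp.zero_apply,
      if_neg (fun hh => h hh.2.1), zero_mul]

variable [Fintype ι] [DecidableEq ι]

/-- `T_{M_N(A)}` (basis `E_{ij} ⊗ b_x`) is a relabelling, hence a restriction, of `⟨N,N,N⟩ ⊗ T_A`. -/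
theorem tensorRestrictsTo_structureTensor_basisMatrix :
    TensorRestrictsTo (kroneckerTensor (matMulTensor K N N N) (structureTensor b))
      (structureTensor (b.matrix (Fin N) (Fin N))) := by
  have key : structureTensor (b.matrix (Fin N) (Fin N)) = fun z x y =>
      kroneckerTensor (matMulTensor K N N N) (structureTensor b)
        ((z.1, z.2.1), z.2.2) ((x.1, x.2.1), x.2.2) ((y.1, y.2.1), y.2.2) := by
    funext z x y
    rw [structureTensor_basisMatrix_apply, kroneckerTensor_apply]
  rw [key]
  exact tensorRestrictsTo_precomp _ _ _ _

/-- `R̃(T_{M_N(A)}) ≤ R̃(⟨N,N,N⟩) · R̃(T_A)` (monotonicity of `R̃` under restriction and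
`R̃(s ⊗ s') ≤ R̃(s) R̃(s')`). -/
theorem asymptoticRank_structureTensor_basisMatrix_le :
    asymptoticRank (structureTensor (b.matrix (Fin N) (Fin N))) ≤
      asymptoticRank (matMulTensor K N N N) * asymptoticRank (structureTensor b) :=
  (asymptoticRank_le_of_polyDegeneratesTo
    (tensorRestrictsTo_structureTensor_basisMatrix b N).polyDegeneratesTo).trans
    (asymptoticRank_kronecker_le _ _)

end StructureTensors

/-! ## Assembly -/

/-- `R̃(⟨N,N,N⟩) ≤ N^ω` for every `N` (including the empty format `N = 0`). -/
theorem asymptoticRank_matMulTensor_le_rpow (N : ℕ) :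
    asymptoticRank (matMulTensor ℂ N N N) ≤ (N : ℝ) ^ omega ℂ := by
  rcases Nat.eq_zero_or_pos N with rfl | hN
  · refine (asymptoticRank_le_tensorRank_pow_one _).trans ?_
    have h0 : kroneckerPow (matMulTensor ℂ 0 0 0) 1 = 0 := by
      funext a
      exact Fin.elim0 (a 0).1
    rw [h0, tensorRank_zero, Nat.cast_zero]
    exact Real.rpow_nonneg le_rfl _
  · exact asymptoticRank_matMulTensor_le_rpow_omega ℂ N hN

/-- STUB 3 — COST OF THE TRUNCATED MATRIX HOST (provable now).  For every number `k` of Casimir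
variables there is `κ > 0` (e.g. `2^k`; in truth `1`, by Bini's border rank `t` of `ℂ[z]/z^t`) such that
any hosting of `⟨n,l,p⟩` in `M_N(ℂ[z₁..z_k]/(zᵢ^t))` forces `(n l p)^(ω/3) ≤ κ · N^ω · t^k` — the
route's proved `HostingBound` (`Theorems.hostingBound_proof`), `R̃(s ⊠ t) ≤ R̃(s) R̃(t)`
(`asymptoticRank_kronecker_le`), `R̃⟨N,N,N⟩ = N^ω` (`asymptoticRank_matMulTensor`) and
`R̃(T_{ℂ[z]/z^t}) ≤ t` (resp. `≤ 2t - 1` inside a cyclic group algebra). -/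
theorem stub_truncatedMatrixCost :
    ∀ k : ℕ, ∃ κ : ℝ, 0 < κ ∧ ∀ (t N n l p : ℕ)
      (α : Matrix (Fin n) (Fin l) ℂ →ₗ[ℂ]
          Matrix (Fin N) (Fin N) (MvPolynomial (Fin k) ℂ ⧸
            Ideal.span (Set.range fun i : Fin k => (MvPolynomial.X i : MvPolynomial (Fin k) ℂ) ^ t)))
      (β : Matrix (Fin l) (Fin p) ℂ →ₗ[ℂ]
          Matrix (Fin N) (Fin N) (MvPolynomial (Fin k) ℂ ⧸
            Ideal.span (Set.range fun i : Fin k => (MvPolynomial.X i : MvPolynomial (Fin k) ℂ) ^ t)))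
      (γ : Matrix (Fin N) (Fin N) (MvPolynomial (Fin k) ℂ ⧸
            Ideal.span (Set.range fun i : Fin k => (MvPolynomial.X i : MvPolynomial (Fin k) ℂ) ^ t))
          →ₗ[ℂ] Matrix (Fin n) (Fin p) ℂ),
      (∀ (M : Matrix (Fin n) (Fin l) ℂ) (M' : Matrix (Fin l) (Fin p) ℂ), γ (α M * β M') = M * M') →
      ((n * l * p : ℕ) : ℝ) ^ (Literature.Computability.AlgebraicComplexity.omega ℂ / 3) ≤
        κ * (N : ℝ) ^ Literature.Computability.AlgebraicComplexity.omega ℂ * (t : ℝ) ^ k := by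
  intro k
  refine ⟨1, one_pos, ?_⟩
  intro t N n l p α β γ hhost
  -- the structure tensor of `R_{k,t}` in the monomial basis is `T_t^{⊗k}`
  have hT := structureTensor_basisMk_eq_kroneckerPow (linearIndependent_mono k t) (span_mono k t)
    (mono_mul_mono k t)
  -- hosting bound in `A = M_N(R_{k,t})` with the basis `E_{ij} ⊗ z^e`
  have h1 := hostingBound_proof (Matrix (Fin N) (Fin N) (MvPolynomial (Fin k) ℂ ⧸
      Ideal.span (Set.range fun i : Fin k => (MvPolynomial.X i : MvPolynomial (Fin k) ℂ) ^ t)))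
    (Fin N × Fin N × (Fin k → Fin t))
    ((Module.Basis.mk (linearIndependent_mono k t) (span_mono k t)).matrix (Fin N) (Fin N))
    n l p α β γ hhost
  -- `R̃(T_A) ≤ R̃(⟨N,N,N⟩) · R̃(T_t^{⊗k}) ≤ N^ω · t^k`
  have h2 := asymptoticRank_structureTensor_basisMatrix_le
    (Module.Basis.mk (linearIndependent_mono k t) (span_mono k t)) N
  rw [hT] at h2
  rw [one_mul]
  exact h1.trans (h2.trans (mul_le_mul (asymptoticRank_matMulTensor_le_rpow N)
    (asymptoticRank_kroneckerPow_truncPoly_le k t) (asymptoticRank_nonneg _)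
    (Real.rpow_nonneg (Nat.cast_nonneg _) _)))

end Summit.MatrixMultiplication.MatrixMultiplication.Theorems.UnitriangularCostShape

end
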